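import Mathlib
import Literature.Analysis.FluidPDE.ChoiEtAl2017PeriodicHouLuoKernel
import Literature.Analysis.FluidPDE.ChoiEtAl2017PeriodicHouLuoVelocity
import Literature.Analysis.FluidPDE.ChoiEtAl2017PeriodicHouLuoSignPreservation
import Literature.Analysis.FluidPDE.ChoiEtAl2017PeriodicHouLuoFunctional
import HarnessLib

/-!
# Choi–Hou–Kiselev–Luo–Šverák–Yao 2017, §4 proof of Theorem 1 (periodic case): the assembly
# — blow-up of `I(t) = ∫₀^{L/2} θ cot(μx) dx`, conditional on Lemma 7 and on symmetry persistence

HONEST FRAMING (cell ns-blowup GROUP B «PROFILE SEARCH», zones Z3-b′ / Z8 = the Hou–Luo boundary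
MODEL): **1-D MODEL (Hou–Luo), not Euler/NS.** Proof-only companion of
`ChoiEtAl2017PeriodicHouLuoBlowup.lean` (the named fact `choiEtAl2017_periodicHouLuo_blowup` =
CHKLSY Thm 1, periodic case) and of `…Kernel.lean`, `…Velocity.lean`, `…SignPreservation.lean`,
`…Functional.lean`. Source: K. Choi, T. Y. Hou, A. Kiselev, G. Luo, V. Šverák, Y. Yao, Comm. Pure
Appl. Math. **70** (2017) 2218–2243 = arXiv:1407.4776 [ChoiHouKiselevLuoSverakYao2017], §4
pp. 11–13 (held text `paper:arxiv-1407.4776` p0011–p0013).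

## What is proved (no definitions of Prop type, no named facts; net debt 0)

The DYNAMIC part of the printed proof and its final assembly, with the two remaining printed inputs
— Lemma 7 (`∫ₐ^{L/2} ω (u cot(μx))_x dx ≥ 0`) and the symmetry clause of p. 11 ("`θ_x, ω, u` stay
odd … `θ(0) = 0`", i.e. uniqueness of smooth solutions) — taken as HYPOTHESES of the final theorem
(they are distinct printed statements, stages [E] and [C] of the discharge plan; nothing is assumed
about the conclusion):

* `theta_zero_of_symmetric` — `θ(t, 0) = 0` along a classical solution with odd vorticity slices
  (`θ_t(t,0) = −u(t,0)θ_x(t,0) = 0`, `u(t,0) = 0`);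
* `hasDerivAt_cotFunctional` — **`dI/dt = −∫₀^{L/2} u θ_x cot(μx) dx`** for `t > 0` along a
  classical periodic HL solution that is jointly `C^∞` on `{t ≥ 0}` (differentiation under the
  integral sign, dominated by a constant: `|u cot(μx)| ≤ ‖u_x‖_∞ L/π`);
* `hasDerivAt_J` — `d/dt (2/π)∫₀^{L/2} θω cot = (2/π)∫₀^{L/2} [−u(θ_xω + θω_x) + θθ_x] cot dx`;
* `continuousOn_cotFunctional`, `continuousOn_J` — continuity of `I`, `J` on `[0, ∞)`;
* `integral_mul_nonneg_of_tails_nonneg` — the layer-cake step turning Lemma 7 (tails `≥ 0`) and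
  `θ_x ≥ 0`, `θ(0) = 0` into `T₁ = (2/π)∫ θω (u cot)_x ≥ 0`;
* **`not_isGlobalSmooth_of_symmetric_of_lemma7`** — for a datum of the printed class
  (`IsBlowupDatum`) and a would-be global smooth solution (`IsGlobalSmoothPeriodicHouLuoSolution`)
  whose slices stay odd (`ω(t)`, `θ_x(t)` odd for `t ≥ 0`), IF Lemma 7 holds for the smooth odd
  periodic vorticities `ω ≥ 0` on `[0, ½L]`, THEN `False`: `I(0) > 0`, `J(0) ≥ 0`, `I′ ≥ J`
  (`first_functional_inequality`), `J′ = T₁ + T₂ ≥ (2/L²) I²` (`T1_by_parts`, Lemma 7,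
  `T2_inequality`), contradiction by `not_global_of_quadratic_feedback₂` ((gengron)).

So after this file the discharge of `choiEtAl2017_periodicHouLuo_blowup` is CLOSED MODULO exactly:
(E) Lemma 7 of the paper, and (C) the symmetry persistence (= uniqueness of smooth `L`-periodic HL
solutions, printed as local well-posedness on p. 6).

WHAT THIS IS NOT: not Euler, not Navier–Stokes; no unconditional blow-up is asserted here — the
assembly of the printed argument for the 1-D periodic wall MODEL with its two remaining lemmas as
hypotheses. `violates:` none — MODEL.
-/

noncomputable section

open Set Filter Real MeasureTheory intervalIntegral
open _root_.Topology

namespace Literature.Analysis.FluidPDE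

namespace ChoiEtAl2017

/-! ### §1 Plumbing: slices and uniform bounds from joint smoothness on `{t ≥ 0}` -/

/-- Slices of a jointly `Cⁿ` function on the closed half-plane are `Cⁿ` (for `t ≥ 0`). [folklore] -/
private theorem slice_contDiff {θ : ℝ → ℝ → ℝ} {n : WithTop ℕ∞}
    (hθ : ContDiffOn ℝ n (fun p : ℝ × ℝ => θ p.1 p.2) {p : ℝ × ℝ | 0 ≤ p.1}) {t : ℝ} (ht : 0 ≤ t) :
    ContDiff ℝ n (θ t) :=
  hθ.comp_contDiff (contDiff_const.prodMk contDiff_id) fun _ => ht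

/-- On the closed half-plane, `deriv (θ t) x` is the within-derivative of `(t,x) ↦ θ t x` applied to
`(0,1)`. [folklore] -/
private theorem deriv_slice_eq_fderivWithin' {θ : ℝ → ℝ → ℝ}
    (hθ : ContDiffOn ℝ 1 (fun p : ℝ × ℝ => θ p.1 p.2) {p : ℝ × ℝ | 0 ≤ p.1}) {p : ℝ × ℝ}
    (hp : 0 ≤ p.1) :
    deriv (θ p.1) p.2 =
      fderivWithin ℝ (fun p : ℝ × ℝ => θ p.1 p.2) {p : ℝ × ℝ | 0 ≤ p.1} p ((0 : ℝ), (1 : ℝ)) := by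
  have hd := (hθ.differentiableOn (by norm_num) p hp).hasFDerivWithinAt
  have hι : HasDerivWithinAt (fun x : ℝ => (p.1, x)) ((0 : ℝ), (1 : ℝ)) univ p.2 :=
    ((hasDerivAt_const p.2 p.1).prodMk (hasDerivAt_id p.2)).hasDerivWithinAt
  have hmaps : MapsTo (fun x : ℝ => (p.1, x)) univ {p : ℝ × ℝ | 0 ≤ p.1} := fun x _ => hp
  exact ((hd.comp_hasDerivWithinAt p.2 hι hmaps).hasDerivAt univ_mem).deriv

/-- Joint continuity of `(t,x) ↦ deriv (θ t) x` on the closed half-plane. [folklore] -/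
private theorem continuousOn_deriv_slice' {θ : ℝ → ℝ → ℝ}
    (hθ : ContDiffOn ℝ 1 (fun p : ℝ × ℝ => θ p.1 p.2) {p : ℝ × ℝ | 0 ≤ p.1}) :
    ContinuousOn (fun p : ℝ × ℝ => deriv (θ p.1) p.2) {p : ℝ × ℝ | 0 ≤ p.1} := by
  have hU : UniqueDiffOn ℝ {p : ℝ × ℝ | 0 ≤ p.1} := by
    have h : {p : ℝ × ℝ | 0 ≤ p.1} = Ici (0 : ℝ) ×ˢ (univ : Set ℝ) := by ext p; simp
    rw [h]
    exact (uniqueDiffOn_Ici 0).prod uniqueDiffOn_univ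
  have hc := hθ.continuousOn_fderivWithin hU le_rfl
  exact (hc.clm_apply continuousOn_const).congr fun p hp => deriv_slice_eq_fderivWithin' hθ hp

/-- A uniform bound for `|deriv (ω t) x|` on `[0,T] × ℝ` for jointly `C¹` `ω` with `L`-periodic
slices. [folklore] -/
private theorem exists_bound_deriv_slice' {ω : ℝ → ℝ → ℝ} {L T : ℝ} (hL : 0 < L)
    (hω : ContDiffOn ℝ 1 (fun p : ℝ × ℝ => ω p.1 p.2) {p : ℝ × ℝ | 0 ≤ p.1})
    (hper : ∀ t ∈ Icc 0 T, Function.Periodic (ω t) L) :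
    ∃ M : ℝ, 0 ≤ M ∧ ∀ t ∈ Icc 0 T, ∀ x, |deriv (ω t) x| ≤ M := by
  have hcont := (continuousOn_deriv_slice' hω).mono
    (show Icc (0 : ℝ) T ×ˢ Icc (0 : ℝ) L ⊆ {p : ℝ × ℝ | 0 ≤ p.1} from fun p hp => hp.1.1)
  obtain ⟨C, hC⟩ := (isCompact_Icc.prod isCompact_Icc).exists_bound_of_continuousOn hcont
  refine ⟨max C 0, le_max_right _ _, fun t ht x => ?_⟩
  have hperd : Function.Periodic (deriv (ω t)) L := by
    intro y
    have h : (fun z => ω t (z + L)) = ω t := funext fun z => hper t ht z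
    rw [← deriv_comp_add_const, h]
  obtain ⟨y, hy, hxy⟩ := hperd.exists_mem_Ico₀ hL x
  rw [hxy]
  have h := hC (t, y) ⟨ht, ⟨hy.1, hy.2.le⟩⟩
  rw [Real.norm_eq_abs] at h
  exact h.trans (le_max_left _ _)

/-- Measurability of `y ↦ g(y)·cot(μy)` for continuous `g`. [folklore] -/
private theorem measurable_mul_cot {g : ℝ → ℝ} (hg : Continuous g) (L : ℝ) :
    Measurable fun y => g y * Real.cot (π * y / L) := by
  have h : (fun y => g y * Real.cot (π * y / L)) =
      fun y => g y * (Real.cos (π * y / L) / Real.sin (π * y / L)) :=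
    funext fun y => by rw [Real.cot_eq_cos_div_sin]
  rw [h]
  exact hg.measurable.mul ((Real.continuous_cos.measurable.comp (by fun_prop)).div
    (Real.continuous_sin.measurable.comp (by fun_prop)))

/-- An odd function vanishes at `0`. [folklore] -/
private theorem odd_zero' {f : ℝ → ℝ} (hodd : ∀ y, f (-y) = -f y) : f 0 = 0 := by
  have h := hodd 0
  rw [neg_zero] at h
  linarith

/-! ### §2 `θ(t,0) = 0` along the flow -/

/-- **`θ(0) = 0` is preserved** (p. 11 "`θ(0) = 0`" in the list of preserved properties): along a
classical periodic HL solution on `[0,T')` whose vorticity slices are odd and `L`-periodic,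
`θ(t,0) = θ(0,0)` for `t ∈ [0,T')` — since `u(t,0) = 0` (`periodicHLVelocity_zero_pt`) the
transport equation gives `∂_t θ(t,0) = 0`.
[cite: ChoiHouKiselevLuoSverakYao2017, §4 p. 11 (θ(0) = 0 is preserved)] -/
theorem theta_zero_of_symmetric {L T' : ℝ} {ω θ : ℝ → ℝ → ℝ}
    (hsol : IsPeriodicHouLuoSolution L ω θ T')
    (hωodd : ∀ t ∈ Ico 0 T', ∀ y, ω t (-y) = -ω t y) {t : ℝ} (ht : t ∈ Ico 0 T') :
    θ t 0 = θ 0 0 := by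
  rcases eq_or_lt_of_le ht.1 with h0 | h0
  · rw [← h0]
  set g : ℝ → ℝ := fun s => θ s 0 with hg
  have hderiv : ∀ s ∈ Ioo 0 T', HasDerivAt g 0 s := by
    intro s hs
    have h := (hsol.2.2 s hs 0).2
    have hu : periodicHLVelocity L (ω s) 0 = 0 :=
      periodicHLVelocity_zero_pt (hωodd s ⟨hs.1.le, hs.2⟩) (hsol.1 s ⟨hs.1.le, hs.2⟩).2.2.1
    rw [hu, zero_mul, neg_zero] at h
    exact h
  have hcont : ContinuousOn g (Icc 0 t) := by
    intro s hs
    rcases eq_or_lt_of_le hs.1 with hs0 | hs0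
    · rw [← hs0]
      exact ((hsol.2.1 0).2).mono Icc_subset_Ici_self
    · exact ((hderiv s ⟨hs0, lt_of_le_of_lt hs.2 ht.2⟩).continuousAt).continuousWithinAt
  have hdiff : DifferentiableOn ℝ g (Ioo 0 t) := fun s hs =>
    ((hderiv s ⟨hs.1, hs.2.trans ht.2⟩).differentiableAt).differentiableWithinAt
  obtain ⟨c, hc, hslope⟩ := exists_deriv_eq_slope g h0 hcont hdiff
  rw [(hderiv c ⟨hc.1, hc.2.trans ht.2⟩).deriv] at hslope
  have : g t - g 0 = 0 := by
    have h := hslope.symm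
    rw [div_eq_iff (by linarith)] at h
    linarith
  show g t = g 0
  linarith

/-! ### §3 The layer-cake step: tails `≥ 0` and `θ_x ≥ 0`, `θ(0) = 0` give `∫ θ g ≥ 0` -/

/-- **From Lemma 7 to `T₁ ≥ 0`** (p. 12–13: "`T₁ ≥ 0`. From Lemma 7, we have … ≥ 0"): if `θ ∈ C¹`,
`θ(0) = 0`, `θ_x ≥ 0` on `[0, ½L]`, and `g` is integrable on `[0, ½L]`, continuous on `(0, ½L)`,
with all tails `∫ₐ^{L/2} g ≥ 0` (`a ∈ [0, ½L]`), then `∫₀^{L/2} θ g ≥ 0`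
(`∫ θ g = ∫ θ_x(a) (∫ₐ^{L/2} g) da` by parts). [cite: ChoiHouKiselevLuoSverakYao2017, §4 proof of Thm 1, pp. 12–13 (T₁ ≥ 0 from Lemma 7)] -/
theorem integral_mul_nonneg_of_tails_nonneg {L : ℝ} (hL : 0 < L) {θ g : ℝ → ℝ}
    (hθ : ContDiff ℝ 1 θ) (hθ0 : θ 0 = 0) (hθx : ∀ x ∈ Icc 0 (L / 2), 0 ≤ deriv θ x)
    (hg : IntervalIntegrable g volume 0 (L / 2)) (hgm : Measurable g)
    (hgc : ∀ x ∈ Ioo 0 (L / 2), ContinuousAt g x)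
    (htails : ∀ a ∈ Icc 0 (L / 2), 0 ≤ ∫ x in a..L / 2, g x) :
    0 ≤ ∫ x in (0 : ℝ)..L / 2, θ x * g x := by
  have hL2 : (0 : ℝ) ≤ L / 2 := by linarith
  have hg' : ∀ x ∈ Icc 0 (L / 2), IntervalIntegrable g volume 0 x := fun x hx =>
    hg.mono_set (by rw [uIcc_of_le hL2, uIcc_of_le hx.1]; exact Icc_subset_Icc le_rfl hx.2)
  set P : ℝ → ℝ := fun x => ∫ y in (0 : ℝ)..x, g y with hP
  have hPcont : ContinuousOn P (Icc 0 (L / 2)) := by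
    have h := intervalIntegral.continuousOn_primitive_interval (μ := volume) (f := g) (a := 0)
      (b := L / 2) (by rw [uIcc_of_le hL2]; exact (intervalIntegrable_iff_integrableOn_Icc_of_le hL2).1 hg)
    rwa [uIcc_of_le hL2] at h
  have hPderiv : ∀ x ∈ Ioo 0 (L / 2), HasDerivAt P (g x) x := fun x hx =>
    intervalIntegral.integral_hasDerivAt_right (hg' x ⟨hx.1.le, hx.2.le⟩)
      hgm.stronglyMeasurable.stronglyMeasurableAtFilter (hgc x hx)
  have htail : ∀ x ∈ Icc 0 (L / 2), ∫ y in x..L / 2, g y = P (L / 2) - P x := fun x hx =>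
    (intervalIntegral.integral_interval_sub_left hg (hg' x hx)).symm
  have hθ'cont : Continuous (deriv θ) := hθ.continuous_deriv le_rfl
  have hRint : IntervalIntegrable (fun x => deriv θ x * (P (L / 2) - P x)) volume 0 (L / 2) := by
    refine ContinuousOn.intervalIntegrable ?_
    rw [uIcc_of_le hL2]
    exact hθ'cont.continuousOn.mul (continuousOn_const.sub hPcont)
  have hθg : IntervalIntegrable (fun y => θ y * g y) volume 0 (L / 2) :=
    hg.continuousOn_mul hθ.continuous.continuousOn
  -- integration by parts
  have hparts : ∫ x in (0 : ℝ)..L / 2, deriv θ x * (P (L / 2) - P x) =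
      ∫ y in (0 : ℝ)..L / 2, θ y * g y := by
    have hΦ : ∫ x in (0 : ℝ)..L / 2, (deriv θ x * (P (L / 2) - P x) - θ x * g x) =
        θ (L / 2) * (P (L / 2) - P (L / 2)) - θ 0 * (P (L / 2) - P 0) := by
      refine intervalIntegral.integral_eq_sub_of_hasDerivAt_of_le hL2
        (hθ.continuous.continuousOn.mul (continuousOn_const.sub hPcont)) ?_ (hRint.sub hθg)
      intro x hx
      have hθd : HasDerivAt θ (deriv θ x) x :=
        ((hθ.differentiable (by norm_num)).differentiableAt).hasDerivAt
      have h : HasDerivAt (fun x => θ x * (P (L / 2) - P x))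
          (deriv θ x * (P (L / 2) - P x) + θ x * (0 - g x)) x :=
        hθd.mul ((hasDerivAt_const x (P (L / 2))).sub (hPderiv x hx))
      refine h.congr_deriv ?_
      ring
    rw [hθ0, sub_self, mul_zero, zero_mul, sub_zero, intervalIntegral.integral_sub hRint hθg] at hΦ
    linarith
  rw [← hparts]
  refine intervalIntegral.integral_nonneg hL2 fun x hx => mul_nonneg (hθx x hx) ?_
  rw [← htail x hx]
  exact htails x hx

/-! ### §4 Uniform bounds on a time strip; `dI/dt`, `dJ/dt`; continuity of `I`, `J` -/

/-- Mean value bound: `g ∈ C¹`, `g(0) = 0`, `|g'| ≤ C` on `[0, b]` ⇒ `|g(y)| ≤ C·y` on `[0, b]`.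
[folklore] -/
private theorem abs_le_mul_of_deriv_bdd {g : ℝ → ℝ} {C b : ℝ} (hg : ContDiff ℝ 1 g)
    (hg0 : g 0 = 0) (hC : ∀ y ∈ Icc 0 b, |deriv g y| ≤ C) {y : ℝ} (hy : y ∈ Icc 0 b) :
    |g y| ≤ C * y := by
  rcases eq_or_lt_of_le hy.1 with h | h
  · rw [← h, hg0]; simp
  have hdiff : Differentiable ℝ g := hg.differentiable (by norm_num)
  obtain ⟨c, hc, hslope⟩ := exists_deriv_eq_slope g h hdiff.continuous.continuousOn
    hdiff.differentiableOn
  rw [hg0, sub_zero, sub_zero] at hslope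
  have hgc : g y = deriv g c * y := by rw [hslope]; field_simp
  rw [hgc, abs_mul, abs_of_pos h]
  exact mul_le_mul_of_nonneg_right (hC c ⟨hc.1.le, hc.2.le.trans hy.2⟩) h.le

/-- **Uniform bounds on a time strip `[0,T] × [0, ½L]`** (`T < T'`) for a classical periodic HL
solution on `[0,T')` that is jointly `C^∞` on `{t ≥ 0}`, with odd vorticity slices and
`θ(t,0) = 0`: one constant `B` bounds `|u cot(μx)|`, `|θ cot(μx)|`, `|θ_x|`, `|ω_x|`, `|ω|`, `|u|`,
`|θ|` there (`u = Qω(t)`). These are the `sup`-norm quantities the printed proof treats as finite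
for a smooth solution ("as long as the solution exists"). [cite: ChoiHouKiselevLuoSverakYao2017, §4 pp. 11–12 (smooth solution: finiteness of the weighted integrals)] -/
theorem exists_uniform_bounds {L T T' : ℝ} (hL : 0 < L) (hTT' : T < T')
    {ω θ : ℝ → ℝ → ℝ} (hsol : IsPeriodicHouLuoSolution L ω θ T')
    (hθs : ContDiffOn ℝ (⊤ : ℕ∞) (fun p : ℝ × ℝ => θ p.1 p.2) {p : ℝ × ℝ | 0 ≤ p.1})
    (hωs : ContDiffOn ℝ (⊤ : ℕ∞) (fun p : ℝ × ℝ => ω p.1 p.2) {p : ℝ × ℝ | 0 ≤ p.1})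
    (hωodd : ∀ t ∈ Ico 0 T', ∀ y, ω t (-y) = -ω t y) (hθzero : ∀ t ∈ Ico 0 T', θ t 0 = 0) :
    ∃ B : ℝ, 0 ≤ B ∧ ∀ s ∈ Icc 0 T, ∀ x ∈ Icc 0 (L / 2),
      |periodicHLVelocity L (ω s) x * Real.cot (π * x / L)| ≤ B ∧
      |θ s x * Real.cot (π * x / L)| ≤ B ∧ |deriv (θ s) x| ≤ B ∧ |deriv (ω s) x| ≤ B ∧
      |ω s x| ≤ B ∧ |periodicHLVelocity L (ω s) x| ≤ B ∧ |θ s x| ≤ B := by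
  have hIcc : ∀ s ∈ Icc 0 T, s ∈ Ico 0 T' := fun s hs => ⟨hs.1, lt_of_le_of_lt hs.2 hTT'⟩
  have hωper : ∀ s ∈ Icc 0 T, Function.Periodic (ω s) L := fun s hs => (hsol.1 s (hIcc s hs)).2.2.1
  have hθper : ∀ s ∈ Icc 0 T, Function.Periodic (θ s) L := fun s hs => (hsol.1 s (hIcc s hs)).2.2.2
  have hθs1 : ContDiffOn ℝ 1 (fun p : ℝ × ℝ => θ p.1 p.2) {p : ℝ × ℝ | 0 ≤ p.1} :=
    hθs.of_le (by exact_mod_cast (le_top : (1 : ℕ∞) ≤ ⊤))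
  have hωs1 : ContDiffOn ℝ 1 (fun p : ℝ × ℝ => ω p.1 p.2) {p : ℝ × ℝ | 0 ≤ p.1} :=
    hωs.of_le (by exact_mod_cast (le_top : (1 : ℕ∞) ≤ ⊤))
  have hθC1 : ∀ s ∈ Icc 0 T, ContDiff ℝ 1 (θ s) := fun s hs =>
    (contDiff_infty.1 (slice_contDiff hθs hs.1)) 1
  have hωC1 : ∀ s ∈ Icc 0 T, ContDiff ℝ 1 (ω s) := fun s hs =>
    (contDiff_infty.1 (slice_contDiff hωs hs.1)) 1
  obtain ⟨Mθ, hMθ0, hMθ⟩ := exists_bound_deriv_slice' (T := T) hL hθs1 hθper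
  obtain ⟨Mω, hMω0, hMω⟩ := exists_bound_deriv_slice' (T := T) hL hωs1 hωper
  set Λ : ℝ := ∫ z in (0 : ℝ)..L, |(Real.log |Real.sin (π * z / L)|)| with hΛ
  have hΛ0 : 0 ≤ Λ := intervalIntegral.integral_nonneg hL.le fun z _ => abs_nonneg _
  set U : ℝ := Mω / π * Λ with hU
  have hU0 : 0 ≤ U := by positivity
  have hu1 : ∀ s ∈ Icc 0 T, ContDiff ℝ 1 (periodicHLVelocity L (ω s)) := fun s hs =>
    contDiff_periodicHLVelocity hL 1 (hωC1 s hs) (hωper s hs)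
  have hu0 : ∀ s ∈ Icc 0 T, periodicHLVelocity L (ω s) 0 = 0 := fun s hs =>
    periodicHLVelocity_zero_pt (hωodd s (hIcc s hs)) (hωper s hs)
  have hux : ∀ s ∈ Icc 0 T, ∀ x, |deriv (periodicHLVelocity L (ω s)) x| ≤ U := fun s hs x =>
    abs_deriv_periodicHLVelocity_le hL (hωC1 s hs) (hωper s hs) (hMω s hs) x
  have hω0 : ∀ s ∈ Icc 0 T, ω s 0 = 0 := fun s hs => odd_zero' (hωodd s (hIcc s hs))
  have hθ0 : ∀ s ∈ Icc 0 T, θ s 0 = 0 := fun s hs => hθzero s (hIcc s hs)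
  refine ⟨U * (L / π) + Mθ * (L / π) + Mθ + Mω + (Mω + U + Mθ) * (L / 2), by positivity,
    fun s hs x hx => ⟨?_, ?_, ?_, ?_, ?_, ?_, ?_⟩⟩
  · have h := abs_mul_cot_phase_le hL (hu1 s hs) (hu0 s hs) (fun y _ => hux s hs y) hx
    have : 0 ≤ Mθ * (L / π) + Mθ + Mω + (Mω + U + Mθ) * (L / 2) := by positivity
    linarith
  · have h := abs_mul_cot_phase_le hL (hθC1 s hs) (hθ0 s hs) (fun y _ => hMθ s hs y) hx
    have : 0 ≤ U * (L / π) + Mθ + Mω + (Mω + U + Mθ) * (L / 2) := by positivity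
    linarith
  · have h := hMθ s hs x
    have : 0 ≤ U * (L / π) + Mθ * (L / π) + Mω + (Mω + U + Mθ) * (L / 2) := by positivity
    linarith
  · have h := hMω s hs x
    have : 0 ≤ U * (L / π) + Mθ * (L / π) + Mθ + (Mω + U + Mθ) * (L / 2) := by positivity
    linarith
  · have h := abs_le_mul_of_deriv_bdd (hωC1 s hs) (hω0 s hs) (fun y _ => hMω s hs y) hx
    have h2 : Mω * x ≤ Mω * (L / 2) := mul_le_mul_of_nonneg_left hx.2 hMω0
    have : 0 ≤ U * (L / π) + Mθ * (L / π) + Mθ + Mω + (U + Mθ) * (L / 2) := by positivity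
    nlinarith
  · have h := abs_le_mul_of_deriv_bdd (hu1 s hs) (hu0 s hs) (fun y _ => hux s hs y) hx
    have h2 : U * x ≤ U * (L / 2) := mul_le_mul_of_nonneg_left hx.2 hU0
    have : 0 ≤ U * (L / π) + Mθ * (L / π) + Mθ + Mω + (Mω + Mθ) * (L / 2) := by positivity
    nlinarith
  · have h := abs_le_mul_of_deriv_bdd (hθC1 s hs) (hθ0 s hs) (fun y _ => hMθ s hs y) hx
    have h2 : Mθ * x ≤ Mθ * (L / 2) := mul_le_mul_of_nonneg_left hx.2 hMθ0
    have : 0 ≤ U * (L / π) + Mθ * (L / π) + Mθ + Mω + (Mω + U) * (L / 2) := by positivity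
    nlinarith

/-- **`dI/dt = −∫₀^{L/2} u θ_x cot(μx) dx`** (p. 12, first equality of the first display:
"`d/dt I(t) = −∫₀^{L/2} u(t,x) θ_x(t,x) cot(μx) dx`", by `θ_t = −uθ_x`): for a classical periodic HL
solution on `[0,T')` (`L > 0`), jointly `C^∞` on `{t ≥ 0}`, with odd vorticity slices and
`θ(t,0) = 0`, at every `t ∈ (0,T')` — differentiation under the integral sign (the `t`-derivative of
the integrand, `−uθ_x cot(μx)`, is bounded by a constant on a time strip, `exists_uniform_bounds`).
[cite: ChoiHouKiselevLuoSverakYao2017, §4 proof of Thm 1, p. 12 (dI/dt = −∫ uθ_x cot(μx) dx)] -/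
theorem hasDerivAt_cotFunctional {L T' : ℝ} (hL : 0 < L) {ω θ : ℝ → ℝ → ℝ}
    (hsol : IsPeriodicHouLuoSolution L ω θ T')
    (hθs : ContDiffOn ℝ (⊤ : ℕ∞) (fun p : ℝ × ℝ => θ p.1 p.2) {p : ℝ × ℝ | 0 ≤ p.1})
    (hωs : ContDiffOn ℝ (⊤ : ℕ∞) (fun p : ℝ × ℝ => ω p.1 p.2) {p : ℝ × ℝ | 0 ≤ p.1})
    (hωodd : ∀ t ∈ Ico 0 T', ∀ y, ω t (-y) = -ω t y) (hθzero : ∀ t ∈ Ico 0 T', θ t 0 = 0)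
    {t : ℝ} (ht : t ∈ Ioo 0 T') :
    HasDerivAt (fun s => cotFunctional L (θ s))
      (-∫ x in (0 : ℝ)..L / 2,
        periodicHLVelocity L (ω t) x * deriv (θ t) x * Real.cot (π * x / L)) t := by
  have hL2 : (0 : ℝ) ≤ L / 2 := by linarith
  -- a time strip `[0, T]` with `t < T < T'` and the neighbourhood `S = (t/2, T)`
  set T : ℝ := (t + T') / 2 with hT
  have htT : t < T := by rw [hT]; linarith [ht.2]
  have hTT' : T < T' := by rw [hT]; linarith [ht.2]
  obtain ⟨B, hB0, hB⟩ := exists_uniform_bounds hL hTT' hsol hθs hωs hωodd hθzero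
  set S : Set ℝ := Ioo (t / 2) T with hS
  have hSmem : S ∈ 𝓝 t := Ioo_mem_nhds (by linarith [ht.1]) htT
  have hSsub : ∀ s ∈ S, s ∈ Icc 0 T ∧ s ∈ Ioo 0 T' := fun s hs =>
    ⟨⟨by linarith [hs.1, ht.1], hs.2.le⟩, ⟨by linarith [hs.1, ht.1], hs.2.trans hTT'⟩⟩
  have hθC1 : ∀ s ∈ Icc 0 T, ContDiff ℝ 1 (θ s) := fun s hs =>
    (contDiff_infty.1 (slice_contDiff hθs hs.1)) 1
  -- the data for the parametric-integral lemma
  set F : ℝ → ℝ → ℝ := fun s x => θ s x * Real.cot (π * x / L) with hF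
  set F' : ℝ → ℝ → ℝ := fun s x =>
    -(periodicHLVelocity L (ω s) x * deriv (θ s) x) * Real.cot (π * x / L) with hF'
  have hF_meas : ∀ᶠ s in 𝓝 t, AEStronglyMeasurable (F s) (volume.restrict (uIoc 0 (L / 2))) := by
    filter_upwards [hSmem] with s hs
    exact (measurable_mul_cot (hθC1 s (hSsub s hs).1).continuous L).aestronglyMeasurable
  have htS : t ∈ S := ⟨by linarith [ht.1], htT⟩
  have hF_int : IntervalIntegrable (F t) volume 0 (L / 2) :=
    intervalIntegrable_mul_cot_phase hL (hθC1 t (hSsub t htS).1) (hθzero t ⟨ht.1.le, ht.2⟩)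
  have hF'_meas : AEStronglyMeasurable (F' t) (volume.restrict (uIoc 0 (L / 2))) := by
    have hc : Continuous fun x => -(periodicHLVelocity L (ω t) x * deriv (θ t) x) := by
      have h1 := (hθC1 t (hSsub t htS).1).continuous_deriv le_rfl
      have hωC1 : ContDiff ℝ 1 (ω t) := (contDiff_infty.1 (slice_contDiff hωs ht.1.le)) 1
      have h2 := (contDiff_periodicHLVelocity hL 1 hωC1 (hsol.1 t ⟨ht.1.le, ht.2⟩).2.2.1).continuous
      exact (h2.mul h1).neg
    exact (measurable_mul_cot hc L).aestronglyMeasurable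
  have h_bound : ∀ᵐ x ∂(volume : Measure ℝ), x ∈ uIoc 0 (L / 2) → ∀ s ∈ S, ‖F' s x‖ ≤ B * B := by
    refine Eventually.of_forall fun x hx s hs => ?_
    rw [uIoc_of_le hL2] at hx
    have hxI : x ∈ Icc 0 (L / 2) := ⟨hx.1.le, hx.2⟩
    obtain ⟨h1, -, h3, -⟩ := hB s (hSsub s hs).1 x hxI
    rw [hF']; dsimp only
    rw [Real.norm_eq_abs, show -(periodicHLVelocity L (ω s) x * deriv (θ s) x) *
      Real.cot (π * x / L) = -((periodicHLVelocity L (ω s) x * Real.cot (π * x / L)) *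
      deriv (θ s) x) by ring, abs_neg, abs_mul]
    exact mul_le_mul h1 h3 (abs_nonneg _) hB0
  have h_diff : ∀ᵐ x ∂(volume : Measure ℝ), x ∈ uIoc 0 (L / 2) → ∀ s ∈ S,
      HasDerivAt (fun s => F s x) (F' s x) s := by
    refine Eventually.of_forall fun x _ s hs => ?_
    have h := (hsol.2.2 s (hSsub s hs).2 x).2
    exact h.mul_const _
  have hmain := intervalIntegral.hasDerivAt_integral_of_dominated_loc_of_deriv_le
    (μ := volume) (a := 0) (b := L / 2) hSmem hF_meas hF_int hF'_meas h_bound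
    (intervalIntegrable_const) h_diff
  have h2 := hmain.2
  have hval : ∫ x in (0 : ℝ)..L / 2, F' t x = -∫ x in (0 : ℝ)..L / 2,
      periodicHLVelocity L (ω t) x * deriv (θ t) x * Real.cot (π * x / L) := by
    rw [← intervalIntegral.integral_neg]
    refine intervalIntegral.integral_congr fun x _ => ?_
    simp only [hF']
    ring
  rw [hval] at h2
  exact h2

/-- **`dJ/dt`** for `J(t) = (2/π)∫₀^{L/2} θω cot(μx) dx` (p. 12: "`d/dt (2/π)∫₀^{L/2} θω cot(μx) dx
= (2/π)∫₀^{L/2} [−u(θω)_x cot(μx) + θθ_x cot(μx)] dx`", by `θ_t = −uθ_x`, `ω_t = −uω_x + θ_x`):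
under the hypotheses of `hasDerivAt_cotFunctional`, at every `t ∈ (0,T')`,
`dJ/dt = (2/π)∫₀^{L/2} [−u(θ_xω + θω_x) + θθ_x] cot(μx) dx`.
[cite: ChoiHouKiselevLuoSverakYao2017, §4 proof of Thm 1, p. 12 (dJ/dt = T₁ + T₂)] -/
theorem hasDerivAt_J {L T' : ℝ} (hL : 0 < L) {ω θ : ℝ → ℝ → ℝ}
    (hsol : IsPeriodicHouLuoSolution L ω θ T')
    (hθs : ContDiffOn ℝ (⊤ : ℕ∞) (fun p : ℝ × ℝ => θ p.1 p.2) {p : ℝ × ℝ | 0 ≤ p.1})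
    (hωs : ContDiffOn ℝ (⊤ : ℕ∞) (fun p : ℝ × ℝ => ω p.1 p.2) {p : ℝ × ℝ | 0 ≤ p.1})
    (hωodd : ∀ t ∈ Ico 0 T', ∀ y, ω t (-y) = -ω t y) (hθzero : ∀ t ∈ Ico 0 T', θ t 0 = 0)
    {t : ℝ} (ht : t ∈ Ioo 0 T') :
    HasDerivAt (fun s => 2 / π * ∫ x in (0 : ℝ)..L / 2, θ s x * (ω s x * Real.cot (π * x / L)))
      (2 / π * ∫ x in (0 : ℝ)..L / 2,
        (-(periodicHLVelocity L (ω t) x * (deriv (θ t) x * ω t x + θ t x * deriv (ω t) x)) +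
          θ t x * deriv (θ t) x) * Real.cot (π * x / L)) t := by
  have hL2 : (0 : ℝ) ≤ L / 2 := by linarith
  set T : ℝ := (t + T') / 2 with hT
  have htT : t < T := by rw [hT]; linarith [ht.2]
  have hTT' : T < T' := by rw [hT]; linarith [ht.2]
  obtain ⟨B, hB0, hB⟩ := exists_uniform_bounds hL hTT' hsol hθs hωs hωodd hθzero
  set S : Set ℝ := Ioo (t / 2) T with hS
  have hSmem : S ∈ 𝓝 t := Ioo_mem_nhds (by linarith [ht.1]) htT
  have hSsub : ∀ s ∈ S, s ∈ Icc 0 T ∧ s ∈ Ioo 0 T' := fun s hs =>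
    ⟨⟨by linarith [hs.1, ht.1], hs.2.le⟩, ⟨by linarith [hs.1, ht.1], hs.2.trans hTT'⟩⟩
  have htS : t ∈ S := ⟨by linarith [ht.1], htT⟩
  have hθC1 : ∀ s ∈ Icc 0 T, ContDiff ℝ 1 (θ s) := fun s hs =>
    (contDiff_infty.1 (slice_contDiff hθs hs.1)) 1
  have hωC1 : ∀ s ∈ Icc 0 T, ContDiff ℝ 1 (ω s) := fun s hs =>
    (contDiff_infty.1 (slice_contDiff hωs hs.1)) 1
  set F : ℝ → ℝ → ℝ := fun s x => θ s x * (ω s x * Real.cot (π * x / L)) with hF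
  set F' : ℝ → ℝ → ℝ := fun s x =>
    (-(periodicHLVelocity L (ω s) x * (deriv (θ s) x * ω s x + θ s x * deriv (ω s) x)) +
      θ s x * deriv (θ s) x) * Real.cot (π * x / L) with hF'
  have hF_meas : ∀ᶠ s in 𝓝 t, AEStronglyMeasurable (F s) (volume.restrict (uIoc 0 (L / 2))) := by
    filter_upwards [hSmem] with s hs
    have h := measurable_mul_cot (((hθC1 s (hSsub s hs).1).continuous).mul
      (hωC1 s (hSsub s hs).1).continuous) L
    exact (h.aestronglyMeasurable).congr (Eventually.of_forall fun x => by
      simp only [hF, Pi.mul_apply]; ring)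
  have hF_int : IntervalIntegrable (F t) volume 0 (L / 2) := by
    have h := (intervalIntegrable_mul_cot_phase hL (hωC1 t (hSsub t htS).1)
      (odd_zero' (hωodd t ⟨ht.1.le, ht.2⟩))).continuousOn_mul
      ((hθC1 t (hSsub t htS).1).continuous.continuousOn (s := uIcc 0 (L / 2)))
    exact h
  have hF'_meas : AEStronglyMeasurable (F' t) (volume.restrict (uIoc 0 (L / 2))) := by
    have hc : Continuous fun x =>
        -(periodicHLVelocity L (ω t) x * (deriv (θ t) x * ω t x + θ t x * deriv (ω t) x)) +
          θ t x * deriv (θ t) x := by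
      have h1 := (hθC1 t (hSsub t htS).1).continuous_deriv le_rfl
      have h1' := (hθC1 t (hSsub t htS).1).continuous
      have h3 := (hωC1 t (hSsub t htS).1).continuous_deriv le_rfl
      have h3' := (hωC1 t (hSsub t htS).1).continuous
      have h2 := (contDiff_periodicHLVelocity hL 1 (hωC1 t (hSsub t htS).1)
        (hsol.1 t ⟨ht.1.le, ht.2⟩).2.2.1).continuous
      exact ((h2.mul ((h1.mul h3').add (h1'.mul h3))).neg).add (h1'.mul h1)
    exact (measurable_mul_cot hc L).aestronglyMeasurable
  have h_bound : ∀ᵐ x ∂(volume : Measure ℝ), x ∈ uIoc 0 (L / 2) → ∀ s ∈ S,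
      ‖F' s x‖ ≤ B * (B * B + B * B) + B * B := by
    refine Eventually.of_forall fun x hx s hs => ?_
    rw [uIoc_of_le hL2] at hx
    have hxI : x ∈ Icc 0 (L / 2) := ⟨hx.1.le, hx.2⟩
    obtain ⟨h1, h2, h3, h4, h5, -, h7⟩ := hB s (hSsub s hs).1 x hxI
    rw [hF']; dsimp only
    rw [Real.norm_eq_abs]
    set u := periodicHLVelocity L (ω s) x
    set c := Real.cot (π * x / L)
    have hsplit : (-(u * (deriv (θ s) x * ω s x + θ s x * deriv (ω s) x)) +
        θ s x * deriv (θ s) x) * c =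
        -((u * c) * (deriv (θ s) x * ω s x + θ s x * deriv (ω s) x)) +
          (θ s x * c) * deriv (θ s) x := by ring
    rw [hsplit]
    refine (abs_add_le _ _).trans (add_le_add ?_ ?_)
    · rw [abs_neg, abs_mul]
      refine mul_le_mul h1 ?_ (abs_nonneg _) hB0
      refine (abs_add_le _ _).trans (add_le_add ?_ ?_)
      · rw [abs_mul]; exact mul_le_mul h3 h5 (abs_nonneg _) hB0
      · rw [abs_mul]; exact mul_le_mul h7 h4 (abs_nonneg _) hB0
    · rw [abs_mul]; exact mul_le_mul h2 h3 (abs_nonneg _) hB0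
  have h_diff : ∀ᵐ x ∂(volume : Measure ℝ), x ∈ uIoc 0 (L / 2) → ∀ s ∈ S,
      HasDerivAt (fun s => F s x) (F' s x) s := by
    refine Eventually.of_forall fun x _ s hs => ?_
    have hθ' := (hsol.2.2 s (hSsub s hs).2 x).2
    have hω' := (hsol.2.2 s (hSsub s hs).2 x).1
    have h := hθ'.mul (hω'.mul_const (Real.cot (π * x / L)))
    refine h.congr_deriv ?_
    simp only [hF']
    ring
  have hmain := intervalIntegral.hasDerivAt_integral_of_dominated_loc_of_deriv_le
    (μ := volume) (a := 0) (b := L / 2) hSmem hF_meas hF_int hF'_meas h_bound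
    (intervalIntegrable_const) h_diff
  exact hmain.2.const_mul (2 / π)

/-- **Continuity of `t ↦ ∫₀^{L/2} θ(t,x) g(t,x) cot(μx) dx`-type functionals on `[0,∞)`**, in the two
instances needed: `I(t) = ∫₀^{L/2} θ cot(μx)` and `J(t) = (2/π)∫₀^{L/2} θω cot(μx)` are continuous
within `[0, T')` at every `t₀ ∈ [0,T')` (dominated convergence with a constant bound on a time strip;
at `t₀ = 0` the orbits are continuous from the right by the solution notion).
[cite: ChoiHouKiselevLuoSverakYao2017, §4 proof of Thm 1, pp. 12–13 (I(t), J(t) along the solution)] -/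
theorem continuousWithinAt_functionals {L T' : ℝ} (hL : 0 < L) {ω θ : ℝ → ℝ → ℝ}
    (hsol : IsPeriodicHouLuoSolution L ω θ T')
    (hθs : ContDiffOn ℝ (⊤ : ℕ∞) (fun p : ℝ × ℝ => θ p.1 p.2) {p : ℝ × ℝ | 0 ≤ p.1})
    (hωs : ContDiffOn ℝ (⊤ : ℕ∞) (fun p : ℝ × ℝ => ω p.1 p.2) {p : ℝ × ℝ | 0 ≤ p.1})
    (hωodd : ∀ t ∈ Ico 0 T', ∀ y, ω t (-y) = -ω t y) (hθzero : ∀ t ∈ Ico 0 T', θ t 0 = 0)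
    {t₀ : ℝ} (ht₀ : t₀ ∈ Ico 0 T') :
    ContinuousWithinAt (fun s => cotFunctional L (θ s)) (Ici 0) t₀ ∧
    ContinuousWithinAt
      (fun s => 2 / π * ∫ x in (0 : ℝ)..L / 2, θ s x * (ω s x * Real.cot (π * x / L)))
      (Ici 0) t₀ := by
  have hL2 : (0 : ℝ) ≤ L / 2 := by linarith
  set T : ℝ := (t₀ + T') / 2 with hT
  have htT : t₀ < T := by rw [hT]; linarith [ht₀.2]
  have hTT' : T < T' := by rw [hT]; linarith [ht₀.2]
  obtain ⟨B, hB0, hB⟩ := exists_uniform_bounds hL hTT' hsol hθs hωs hωodd hθzero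
  -- the neighbourhood `[0, T) ∩ [0,∞)` of `t₀` within `[0, ∞)`
  have hN : Ico 0 T ∈ 𝓝[Ici 0] t₀ := by
    have h : Ici 0 ∩ Iio T ∈ 𝓝[Ici 0] t₀ := inter_mem_nhdsWithin (Ici 0) (Iio_mem_nhds htT)
    exact Filter.mem_of_superset h fun s hs => ⟨hs.1, hs.2⟩
  have hθC1 : ∀ s ∈ Icc 0 T, ContDiff ℝ 1 (θ s) := fun s hs =>
    (contDiff_infty.1 (slice_contDiff hθs hs.1)) 1
  have hωC1 : ∀ s ∈ Icc 0 T, ContDiff ℝ 1 (ω s) := fun s hs =>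
    (contDiff_infty.1 (slice_contDiff hωs hs.1)) 1
  -- continuity of the orbits within `[0, ∞)` at `t₀`
  have horbit : ∀ x, ContinuousWithinAt (fun s => θ s x) (Ici 0) t₀ ∧
      ContinuousWithinAt (fun s => ω s x) (Ici 0) t₀ := by
    intro x
    rcases eq_or_lt_of_le ht₀.1 with h0 | h0
    · rw [← h0]; exact ⟨(hsol.2.1 x).2, (hsol.2.1 x).1⟩
    · have h := hsol.2.2 t₀ ⟨h0, ht₀.2⟩ x
      exact ⟨h.2.continuousAt.continuousWithinAt, h.1.continuousAt.continuousWithinAt⟩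
  constructor
  · refine intervalIntegral.continuousWithinAt_of_dominated_interval (bound := fun _ => B) ?_ ?_
      intervalIntegrable_const ?_
    · filter_upwards [hN] with s hs
      exact (measurable_mul_cot (hθC1 s ⟨hs.1, hs.2.le⟩).continuous L).aestronglyMeasurable
    · filter_upwards [hN] with s hs
      refine Eventually.of_forall fun x hx => ?_
      rw [uIoc_of_le hL2] at hx
      rw [Real.norm_eq_abs]
      exact (hB s ⟨hs.1, hs.2.le⟩ x ⟨hx.1.le, hx.2⟩).2.1
    · exact Eventually.of_forall fun x _ => (horbit x).1.mul continuousWithinAt_const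
  · have h : ContinuousWithinAt
        (fun s => ∫ x in (0 : ℝ)..L / 2, θ s x * (ω s x * Real.cot (π * x / L))) (Ici 0) t₀ := by
      refine intervalIntegral.continuousWithinAt_of_dominated_interval (bound := fun _ => B * B)
        ?_ ?_ intervalIntegrable_const ?_
      · filter_upwards [hN] with s hs
        have h := measurable_mul_cot (((hθC1 s ⟨hs.1, hs.2.le⟩).continuous).mul
          (hωC1 s ⟨hs.1, hs.2.le⟩).continuous) L
        exact (h.aestronglyMeasurable).congr (Eventually.of_forall fun x => by
          simp only [Pi.mul_apply]; ring)
      · filter_upwards [hN] with s hs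
        refine Eventually.of_forall fun x hx => ?_
        rw [uIoc_of_le hL2] at hx
        have hxI : x ∈ Icc 0 (L / 2) := ⟨hx.1.le, hx.2⟩
        obtain ⟨-, h2, -, -, h5, -⟩ := hB s ⟨hs.1, hs.2.le⟩ x hxI
        rw [Real.norm_eq_abs, show θ s x * (ω s x * Real.cot (π * x / L)) =
          (θ s x * Real.cot (π * x / L)) * ω s x by ring, abs_mul]
        exact mul_le_mul h2 h5 (abs_nonneg _) hB0
      · exact Eventually.of_forall fun x _ =>
          (horbit x).1.mul ((horbit x).2.mul continuousWithinAt_const)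
    exact continuousWithinAt_const.mul h

/-! ### §5 The `T₁` integrand `ω (u cot(μx))_x` is integrable; the split `J' = T₁ + T₂` -/

/-- The phase `μx ∈ (0, π/2)` for `x ∈ (0, ½L)`. [folklore] -/
private theorem phase_Ioo {L x : ℝ} (hL : 0 < L) (hx : x ∈ Ioo 0 (L / 2)) :
    π * x / L ∈ Ioo 0 (π / 2) := by
  constructor
  · exact div_pos (mul_pos Real.pi_pos hx.1) hL
  · rw [div_lt_iff₀ hL]; nlinarith [hx.2, Real.pi_pos]

/-- `cot(μx) ≥ 0` on `[0, ½L]`. [folklore] -/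
private theorem cot_nonneg_phase {L x : ℝ} (hL : 0 < L) (hx : x ∈ Icc 0 (L / 2)) :
    0 ≤ Real.cot (π * x / L) := by
  rw [Real.cot_eq_cos_div_sin]
  refine div_nonneg (Real.cos_nonneg_of_mem_Icc ⟨?_, ?_⟩) (Real.sin_nonneg_of_nonneg_of_le_pi ?_ ?_)
  · have : 0 ≤ π * x / L := div_nonneg (mul_nonneg Real.pi_pos.le hx.1) hL.le
    linarith [Real.pi_pos]
  · rw [div_le_iff₀ hL]; nlinarith [hx.2, Real.pi_pos]
  · exact div_nonneg (mul_nonneg Real.pi_pos.le hx.1) hL.le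
  · rw [div_le_iff₀ hL]; nlinarith [hx.2, hx.1, Real.pi_pos]

/-- On `(0, ½L]`: `sin(μx) > 0`, `x cot(μx) ≤ L/π`, `x ≤ (L/2) sin(μx)`. [folklore] -/
private theorem phase_bounds {L x : ℝ} (hL : 0 < L) (hx : x ∈ Ioc 0 (L / 2)) :
    0 < Real.sin (π * x / L) ∧ x * Real.cot (π * x / L) ≤ L / π ∧
      x ≤ L / 2 * Real.sin (π * x / L) := by
  rcases eq_or_lt_of_le hx.2 with h | h
  · rw [h, show π * (L / 2) / L = π / 2 by field_simp, Real.sin_pi_div_two, Real.cot_eq_cos_div_sin,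
      Real.cos_pi_div_two, zero_div, mul_zero]
    exact ⟨one_pos, by positivity, by linarith⟩
  have hph := phase_Ioo hL ⟨hx.1, h⟩
  have hsin : 0 < Real.sin (π * x / L) :=
    Real.sin_pos_of_pos_of_lt_pi hph.1 (by linarith [hph.2, Real.pi_pos])
  refine ⟨hsin, ?_, ?_⟩
  · have htan : 0 < Real.tan (π * x / L) := Real.tan_pos_of_pos_of_lt_pi_div_two hph.1 hph.2
    have hle : π * x / L ≤ Real.tan (π * x / L) := Real.le_tan hph.1.le hph.2
    have hcot : Real.cot (π * x / L) = 1 / Real.tan (π * x / L) := by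
      rw [Real.cot_eq_cos_div_sin, Real.tan_eq_sin_div_cos, one_div, inv_div]
    rw [hcot, mul_one_div, div_le_div_iff₀ htan Real.pi_pos]
    calc x * π = π * x / L * L := by field_simp
      _ ≤ Real.tan (π * x / L) * L := mul_le_mul_of_nonneg_right hle hL.le
      _ = L * Real.tan (π * x / L) := mul_comm _ _
  · have hj : 2 / π * (π * x / L) ≤ Real.sin (π * x / L) := Real.mul_le_sin hph.1.le hph.2.le
    have h2 : 2 / π * (π * x / L) = 2 * x / L := by field_simp
    rw [h2] at hj
    have := mul_le_mul_of_nonneg_left hj (by linarith : (0 : ℝ) ≤ L / 2)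
    calc x = L / 2 * (2 * x / L) := by field_simp
      _ ≤ L / 2 * Real.sin (π * x / L) := this

/-- **The `T₁` integrand is integrable**: for `ω ∈ C¹` odd `L`-periodic (`L > 0`) and `u = Qω`,
`g(x) = ω(x)·(u_x cot(μx) − μu/sin²(μx))` is bounded on `(0, ½L]` (by `‖ω'‖‖u_x‖(L/π + μ(L/2)³…)`),
hence integrable on `[0, ½L]`; it is measurable and continuous on `(0, ½L)`. This is the
integrability behind the tails `∫ₐ^{L/2} ω (u cot(μx))_x dx` of Lemma 7.
[cite: ChoiHouKiselevLuoSverakYao2017, §4 Lemma 7 p. 12 (the integral ∫ₐ^{L/2} ω (u cot(μx))_x dx)] -/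
theorem intervalIntegrable_omega_mul_dV {L : ℝ} (hL : 0 < L) {ω : ℝ → ℝ} (hω : ContDiff ℝ 1 ω)
    (hodd : ∀ y, ω (-y) = -ω y) (hper : Function.Periodic ω L) :
    IntervalIntegrable (fun x => ω x * (deriv (periodicHLVelocity L ω) x * Real.cot (π * x / L) -
        π / L * periodicHLVelocity L ω x / Real.sin (π * x / L) ^ 2)) volume 0 (L / 2) ∧
    Measurable (fun x => ω x * (deriv (periodicHLVelocity L ω) x * Real.cot (π * x / L) -
        π / L * periodicHLVelocity L ω x / Real.sin (π * x / L) ^ 2)) ∧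
    ∀ x ∈ Ioo 0 (L / 2), ContinuousAt (fun x => ω x *
      (deriv (periodicHLVelocity L ω) x * Real.cot (π * x / L) -
        π / L * periodicHLVelocity L ω x / Real.sin (π * x / L) ^ 2)) x := by
  have hL2 : (0 : ℝ) ≤ L / 2 := by linarith
  have hω0 : ω 0 = 0 := odd_zero' hodd
  set u : ℝ → ℝ := periodicHLVelocity L ω with hu
  have hu1 : ContDiff ℝ 1 u := contDiff_periodicHLVelocity hL 1 hω hper
  have hu0 : u 0 = 0 := periodicHLVelocity_zero_pt hodd hper
  obtain ⟨U, hU0, hU⟩ := exists_bound_periodicHLVelocity hL hω hper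
  obtain ⟨Cω, hCω⟩ := isCompact_Icc.exists_bound_of_continuousOn
    ((hω.continuous_deriv le_rfl).continuousOn (s := Icc (0 : ℝ) (L / 2)))
  have hCω' : ∀ y ∈ Icc 0 (L / 2), |deriv ω y| ≤ Cω := fun y hy => by
    simpa [Real.norm_eq_abs] using hCω y hy
  have hCω0 : 0 ≤ Cω := (abs_nonneg _).trans (hCω' 0 ⟨le_rfl, hL2⟩)
  -- measurability
  have hcotm : Measurable fun x => Real.cot (π * x / L) := by
    have h := measurable_mul_cot continuous_const (g := fun _ => (1 : ℝ)) L
    simpa using h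
  have hsm : Measurable fun x => Real.sin (π * x / L) :=
    Real.continuous_sin.measurable.comp (by fun_prop)
  have hVm : Measurable fun x => deriv u x * Real.cot (π * x / L) -
      π / L * u x / Real.sin (π * x / L) ^ 2 :=
    ((hu1.continuous_deriv le_rfl).measurable.mul hcotm).sub
      (((hu1.continuous.measurable).const_mul _).div (hsm.pow_const 2))
  have hgm : Measurable fun x => ω x * (deriv u x * Real.cot (π * x / L) -
      π / L * u x / Real.sin (π * x / L) ^ 2) := hω.continuous.measurable.mul hVm
  -- the bound on `(0, ½L]`
  have hbd : ∀ x ∈ Ioc 0 (L / 2), |ω x * (deriv u x * Real.cot (π * x / L) -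
      π / L * u x / Real.sin (π * x / L) ^ 2)| ≤
      Cω * U * (L / π) + π / L * Cω * U * (L / 2) ^ 2 := by
    intro x hx
    have hxI : x ∈ Icc 0 (L / 2) := ⟨hx.1.le, hx.2⟩
    obtain ⟨hs, hxq, hxs⟩ := phase_bounds hL hx
    have hq0 : 0 ≤ Real.cot (π * x / L) := cot_nonneg_phase hL hxI
    have h1 : |ω x| ≤ Cω * x := abs_le_mul_of_deriv_bdd hω hω0 hCω' hxI
    have h3 : |u x| ≤ U * x := abs_le_mul_of_deriv_bdd hu1 hu0 (fun y _ => (hU y).2) hxI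
    have h4 : |deriv u x| ≤ U := (hU x).2
    rw [mul_sub, show ω x * (π / L * u x / Real.sin (π * x / L) ^ 2) =
      π / L * (ω x * u x) / Real.sin (π * x / L) ^ 2 by ring]
    refine (abs_sub _ _).trans (add_le_add ?_ ?_)
    · rw [abs_mul, abs_mul, abs_of_nonneg hq0]
      calc |ω x| * (|deriv u x| * Real.cot (π * x / L)) ≤ Cω * x * (U * Real.cot (π * x / L)) :=
            mul_le_mul h1 (mul_le_mul_of_nonneg_right h4 hq0) (mul_nonneg (abs_nonneg _) hq0)
              (mul_nonneg hCω0 hx.1.le)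
        _ = Cω * U * (x * Real.cot (π * x / L)) := by ring
        _ ≤ Cω * U * (L / π) := mul_le_mul_of_nonneg_left hxq (by positivity)
    · rw [abs_div, abs_mul, abs_mul, abs_of_pos (div_pos Real.pi_pos hL), abs_of_pos (pow_pos hs 2),
        div_le_iff₀ (pow_pos hs 2)]
      have hx3 : x ^ 2 ≤ (L / 2 * Real.sin (π * x / L)) ^ 2 := pow_le_pow_left₀ hx.1.le hxs 2
      have hsle : Real.sin (π * x / L) ≤ 1 := Real.sin_le_one _
      have hxle : x ≤ L / 2 := hx.2
      calc π / L * (|ω x| * |u x|) ≤ π / L * (Cω * x * (U * x)) :=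
            mul_le_mul_of_nonneg_left (mul_le_mul h1 h3 (abs_nonneg _) (mul_nonneg hCω0 hx.1.le))
              (div_pos Real.pi_pos hL).le
        _ = π / L * Cω * U * x ^ 2 := by ring
        _ ≤ π / L * Cω * U * (L / 2 * Real.sin (π * x / L)) ^ 2 :=
            mul_le_mul_of_nonneg_left hx3 (by positivity)
        _ = π / L * Cω * U * (L / 2) ^ 2 * Real.sin (π * x / L) ^ 2 := by ring
  refine ⟨?_, hgm, ?_⟩
  · refine (intervalIntegrable_const (c := Cω * U * (L / π) + π / L * Cω * U * (L / 2) ^ 2)).mono_fun'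
      hgm.aestronglyMeasurable ?_
    refine (ae_restrict_mem measurableSet_uIoc).mono fun x hx => ?_
    rw [uIoc_of_le hL2] at hx
    dsimp only
    rw [Real.norm_eq_abs]
    exact hbd x hx
  · intro x hx
    have hs := (phase_bounds hL ⟨hx.1, hx.2.le⟩).1
    have hcot : ContinuousAt (fun x => Real.cot (π * x / L)) x := by
      have h : (fun x => Real.cot (π * x / L)) =
          fun x => Real.cos (π * x / L) / Real.sin (π * x / L) :=
        funext fun x => Real.cot_eq_cos_div_sin _
      rw [h]
      exact ((Real.continuous_cos.comp (by fun_prop)).continuousAt).div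
        ((Real.continuous_sin.comp (by fun_prop)).continuousAt) hs.ne'
    have hsin : ContinuousAt (fun x => Real.sin (π * x / L) ^ 2) x :=
      ((Real.continuous_sin.comp (by fun_prop)).pow 2).continuousAt
    exact hω.continuous.continuousAt.mul
      ((((hu1.continuous_deriv le_rfl).continuousAt).mul hcot).sub
        (((hu1.continuous.continuousAt).const_mul _).div hsin (pow_pos hs 2).ne'))

/-- `g ∈ C¹`, `g(0) = 0`, `g' ≥ 0` on `[0, b]` ⇒ `g ≥ 0` on `[0, b]`. [folklore] -/
private theorem nonneg_of_deriv_nonneg' {g : ℝ → ℝ} {b : ℝ} (hg : ContDiff ℝ 1 g) (hg0 : g 0 = 0)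
    (hd : ∀ y ∈ Icc 0 b, 0 ≤ deriv g y) {y : ℝ} (hy : y ∈ Icc 0 b) : 0 ≤ g y := by
  rcases eq_or_lt_of_le hy.1 with h | h
  · rw [← h, hg0]
  have hdiff : Differentiable ℝ g := hg.differentiable (by norm_num)
  obtain ⟨c, hc, hslope⟩ := exists_deriv_eq_slope g h hdiff.continuous.continuousOn
    hdiff.differentiableOn
  rw [hg0, sub_zero, sub_zero] at hslope
  have hgc : g y = deriv g c * y := by rw [hslope]; field_simp
  rw [hgc]
  exact mul_nonneg (hd c ⟨hc.1.le, hc.2.le.trans hy.2⟩) h.le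

/-! ### §6 The assembly: blow-up of `I(t)`, conditional on Lemma 7 and on symmetry persistence -/

/-- **CHKLSY Theorem 1 (periodic case), §4 proof — assembled, conditional on its two remaining
printed inputs.** Let `(ω₀, θ₀)` be a datum of the printed class (`IsBlowupDatum L ω₀ θ₀`: `L > 0`,
smooth `L`-periodic, `ω₀` and `θ_{0x}` odd and `≥ 0` on `[0, ½L]`, `θ₀(0) = 0`, `I(0) > 0`) and let
`(ω, θ)` be a would-be global smooth `L`-periodic solution from it
(`IsGlobalSmoothPeriodicHouLuoSolution`). ASSUME (C) the solution keeps the printed symmetry —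
`ω(t)` and `θ_x(t)` odd for all `t ≥ 0` (p. 11, "the evolution preserves the assumptions"; in print a
consequence of uniqueness of smooth solutions) — and (E) **Lemma 7** for smooth odd `L`-periodic
`w ≥ 0` on `[0, ½L]`: `∫ₐ^{L/2} w (u cot(μx))_x dx ≥ 0` for every `a ∈ [0, ½L]`, `u = Qw`. THEN
`False`. Proof as printed (pp. 12–13): `I(t) = ∫₀^{L/2} θ cot(μx)`, `J(t) = (2/π)∫₀^{L/2} θω cot(μx)`;
`I(0) > 0`, `J(0) ≥ 0`; `dI/dt = −∫ uθ_x cot ≥ J` (`hasDerivAt_cotFunctional`,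
`first_functional_inequality`, signs by `sign_persistence_of_symmetric`); `dJ/dt = T₁ + T₂`
(`hasDerivAt_J`, `T1_by_parts`) with `T₁ ≥ 0` (Lemma 7 via `integral_mul_nonneg_of_tails_nonneg`)
and `T₂ ≥ (2/L²) I²` (`T2_inequality`); contradiction by (gengron)
(`not_global_of_quadratic_feedback₂`). This closes the discharge of
`choiEtAl2017_periodicHouLuo_blowup` modulo exactly (C) and (E).
[cite: ChoiHouKiselevLuoSverakYao2017, §4 proof of Thm 1, pp. 11–13 (I(0) > 0 ⇒ finite-time blow-up of I)] -/
theorem not_isGlobalSmooth_of_symmetric_of_lemma7 {L : ℝ} {ω₀ θ₀ : ℝ → ℝ} {ω θ : ℝ → ℝ → ℝ}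
    (hdat : IsBlowupDatum L ω₀ θ₀) (hsol : IsGlobalSmoothPeriodicHouLuoSolution L ω₀ θ₀ ω θ)
    (hωodd : ∀ t : ℝ, 0 ≤ t → ∀ y, ω t (-y) = -ω t y)
    (hθxodd : ∀ t : ℝ, 0 ≤ t → ∀ y, deriv (θ t) (-y) = -deriv (θ t) y)
    (h7 : ∀ w : ℝ → ℝ, ContDiff ℝ (⊤ : ℕ∞) w → (∀ y, w (-y) = -w y) → Function.Periodic w L →
      (∀ y ∈ Icc 0 (L / 2), 0 ≤ w y) → ∀ a ∈ Icc 0 (L / 2),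
        0 ≤ ∫ x in a..L / 2, w x * (deriv (periodicHLVelocity L w) x * Real.cot (π * x / L) -
          π / L * periodicHLVelocity L w x / Real.sin (π * x / L) ^ 2)) :
    False := by
  have hL : 0 < L := hdat.L_pos
  have hL2 : (0 : ℝ) ≤ L / 2 := by linarith
  obtain ⟨hsolT, hωs, hθs, hω0eq, hθ0eq⟩ := hsol
  -- solutions on `[0, t+1)` and bookkeeping for `t ≥ 0`
  have sol : ∀ t : ℝ, 0 ≤ t → IsPeriodicHouLuoSolution L ω θ (t + 1) := fun t ht =>
    hsolT (t + 1) (by linarith)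
  have hωper : ∀ t : ℝ, 0 ≤ t → Function.Periodic (ω t) L := fun t ht =>
    ((sol t ht).1 t ⟨ht, by linarith⟩).2.2.1
  have hθC1 : ∀ t : ℝ, 0 ≤ t → ContDiff ℝ 1 (θ t) := fun t ht =>
    (contDiff_infty.1 (slice_contDiff hθs ht)) 1
  have hωC1 : ∀ t : ℝ, 0 ≤ t → ContDiff ℝ 1 (ω t) := fun t ht =>
    (contDiff_infty.1 (slice_contDiff hωs ht)) 1
  have hωCinf : ∀ t : ℝ, 0 ≤ t → ContDiff ℝ (⊤ : ℕ∞) (ω t) := fun t ht => slice_contDiff hωs ht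
  have hθz : ∀ t : ℝ, 0 ≤ t → θ t 0 = 0 := by
    intro t ht
    have h := theta_zero_of_symmetric (sol t ht) (fun s hs => hωodd s hs.1) ⟨ht, by linarith⟩
    rw [h, hθ0eq, hdat.θ_zero]
  have hωoddT : ∀ T' : ℝ, ∀ s ∈ Ico 0 T', ∀ y, ω s (-y) = -ω s y := fun _ s hs => hωodd s hs.1
  have hθzT : ∀ T' : ℝ, ∀ s ∈ Ico 0 T', θ s 0 = 0 := fun _ s hs => hθz s hs.1
  -- the preserved signs (stage [D])
  have h0θ : ∀ x ∈ Icc 0 (L / 2), 0 ≤ deriv (θ 0) x := by rw [hθ0eq]; exact hdat.dθ_nonneg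
  have h0ω : ∀ x ∈ Icc 0 (L / 2), 0 ≤ ω 0 x := by rw [hω0eq]; exact hdat.ω_nonneg
  have hsigns : ∀ t : ℝ, 0 ≤ t → ∀ x ∈ Icc 0 (L / 2),
      0 ≤ deriv (θ t) x ∧ 0 ≤ ω t x ∧ periodicHLVelocity L (ω t) x ≤ 0 := fun t ht x hx =>
    sign_persistence_of_symmetric hL (show t < t + 1 by linarith) (sol t ht) hθs hωs
      (fun s hs y => hωodd s hs.1 y) (fun s hs y => hθxodd s hs.1 y) h0θ h0ω t ⟨ht, le_rfl⟩ x hx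
  -- the functionals and their derivatives
  set I : ℝ → ℝ := fun t => cotFunctional L (θ t) with hI
  set I' : ℝ → ℝ := fun t => -∫ x in (0 : ℝ)..L / 2,
    periodicHLVelocity L (ω t) x * deriv (θ t) x * Real.cot (π * x / L) with hI'
  set J : ℝ → ℝ := fun t => 2 / π * ∫ x in (0 : ℝ)..L / 2,
    θ t x * (ω t x * Real.cot (π * x / L)) with hJ
  set J' : ℝ → ℝ := fun t => 2 / π * ∫ x in (0 : ℝ)..L / 2,
    (-(periodicHLVelocity L (ω t) x * (deriv (θ t) x * ω t x + θ t x * deriv (ω t) x)) +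
      θ t x * deriv (θ t) x) * Real.cot (π * x / L) with hJ'
  refine not_global_of_quadratic_feedback₂ (I := I) (I' := I') (J := J) (J' := J')
    (c₀ := 2 / L ^ 2) (by positivity) ?_ ?_ ?_ ?_ ?_ ?_ ?_ ?_
  · -- `I(0) > 0`
    show 0 < cotFunctional L (θ 0)
    rw [hθ0eq]; exact hdat.functional_pos
  · -- `J(0) ≥ 0`
    show 0 ≤ 2 / π * ∫ x in (0 : ℝ)..L / 2, θ 0 x * (ω 0 x * Real.cot (π * x / L))
    rw [hθ0eq, hω0eq]
    refine mul_nonneg (by positivity) (intervalIntegral.integral_nonneg hL2 fun x hx => ?_)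
    have hθC1₀ : ContDiff ℝ 1 θ₀ := (contDiff_infty.1 hdat.smooth_θ) 1
    exact mul_nonneg (nonneg_of_deriv_nonneg' hθC1₀ hdat.θ_zero hdat.dθ_nonneg hx)
      (mul_nonneg (hdat.ω_nonneg x hx) (cot_nonneg_phase hL hx))
  · -- continuity of `I`
    intro t₀ ht₀
    exact (continuousWithinAt_functionals hL (sol t₀ ht₀) hθs hωs (hωoddT _) (hθzT _)
      ⟨ht₀, by linarith⟩).1
  · -- continuity of `J`
    intro t₀ ht₀
    exact (continuousWithinAt_functionals hL (sol t₀ ht₀) hθs hωs (hωoddT _) (hθzT _)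
      ⟨ht₀, by linarith⟩).2
  · -- `dI/dt`
    intro t ht
    exact hasDerivAt_cotFunctional hL (sol t ht.le) hθs hωs (hωoddT _) (hθzT _) ⟨ht, by linarith⟩
  · -- `dJ/dt`
    intro t ht
    exact hasDerivAt_J hL (sol t ht.le) hθs hωs (hωoddT _) (hθzT _) ⟨ht, by linarith⟩
  · -- `I' ≥ J`: the first functional inequality
    intro t ht
    exact first_functional_inequality hL (hωC1 t ht.le) (hωodd t ht.le) (hωper t ht.le)
      (fun y hy => (hsigns t ht.le y hy).2.1) (hθC1 t ht.le) (hθz t ht.le)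
      (fun x hx => (hsigns t ht.le x hx).1)
  · -- `J' ≥ (2/L²) I²`: `J' = T₁ + T₂`, `T₁ ≥ 0` (Lemma 7), `T₂ ≥ (2/L²) I²`
    intro t ht
    have ht' : 0 ≤ t := ht.le
    set u : ℝ → ℝ := periodicHLVelocity L (ω t) with hu
    have hu1 : ContDiff ℝ 1 u := contDiff_periodicHLVelocity hL 1 (hωC1 t ht') (hωper t ht')
    have hu0 : u 0 = 0 := periodicHLVelocity_zero_pt (hωodd t ht') (hωper t ht')
    set D : ℝ → ℝ := fun x => deriv (θ t) x * ω t x + θ t x * deriv (ω t) x with hD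
    have hDc : Continuous D :=
      (((hθC1 t ht').continuous_deriv le_rfl).mul (hωC1 t ht').continuous).add
        ((hθC1 t ht').continuous.mul ((hωC1 t ht').continuous_deriv le_rfl))
    -- integrability of the two pieces
    have hA : IntervalIntegrable (fun x => -(u x * D x) * Real.cot (π * x / L)) volume
        0 (L / 2) := by
      have h := ((intervalIntegrable_mul_cot_phase hL hu1 hu0).mul_continuousOn
        (hDc.continuousOn (s := uIcc 0 (L / 2)))).neg
      exact h.congr fun x _ => by simp only [Pi.neg_apply]; ring
    have hB : IntervalIntegrable (fun x => θ t x * deriv (θ t) x * Real.cot (π * x / L)) volume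
        0 (L / 2) := by
      have h := (intervalIntegrable_mul_cot_phase hL (hθC1 t ht') (hθz t ht')).mul_continuousOn
        (((hθC1 t ht').continuous_deriv le_rfl).continuousOn (s := uIcc 0 (L / 2)))
      exact h.congr fun x _ => by ring
    have hsplit : ∫ x in (0 : ℝ)..L / 2, (-(u x * D x) + θ t x * deriv (θ t) x) *
        Real.cot (π * x / L) = (∫ x in (0 : ℝ)..L / 2, -(u x * D x) * Real.cot (π * x / L)) +
        ∫ x in (0 : ℝ)..L / 2, θ t x * deriv (θ t) x * Real.cot (π * x / L) := by
      rw [← intervalIntegral.integral_add hA hB]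
      refine intervalIntegral.integral_congr fun x _ => ?_
      ring
    -- `T₁ = ∫ θ ω V'` and `T₁ ≥ 0`
    set V' : ℝ → ℝ := fun x => deriv u x * Real.cot (π * x / L) -
      π / L * u x / Real.sin (π * x / L) ^ 2 with hV'
    have hT1 : ∫ x in (0 : ℝ)..L / 2, -(u x * D x) * Real.cot (π * x / L) =
        ∫ x in (0 : ℝ)..L / 2, θ t x * ω t x * V' x := by
      have h := T1_by_parts hL (hωC1 t ht') (hωodd t ht') (hωper t ht') (hθC1 t ht') (hθz t ht')
      rw [← h, ← intervalIntegral.integral_neg]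
      refine intervalIntegral.integral_congr fun x _ => ?_
      simp only [hD]
      ring
    have hT1nn : 0 ≤ ∫ x in (0 : ℝ)..L / 2, θ t x * ω t x * V' x := by
      obtain ⟨hg, hgm, hgc⟩ := intervalIntegrable_omega_mul_dV hL (hωC1 t ht') (hωodd t ht')
        (hωper t ht')
      have h := integral_mul_nonneg_of_tails_nonneg hL (hθC1 t ht') (hθz t ht')
        (fun x hx => (hsigns t ht' x hx).1) hg hgm hgc
        (h7 (ω t) (hωCinf t ht') (hωodd t ht') (hωper t ht') fun y hy => (hsigns t ht' y hy).2.1)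
      have heq : ∫ x in (0 : ℝ)..L / 2, θ t x * ω t x * V' x = ∫ x in (0 : ℝ)..L / 2,
          θ t x * (ω t x * (deriv (periodicHLVelocity L (ω t)) x * Real.cot (π * x / L) -
            π / L * periodicHLVelocity L (ω t) x / Real.sin (π * x / L) ^ 2)) :=
        intervalIntegral.integral_congr fun x _ => by simp only [hV', hu]; ring
      rw [heq]; exact h
    -- `T₂ ≥ (2/L²) I²`
    have hT2 := T2_inequality hL (hθC1 t ht') (hθz t ht')
    -- assemble
    show 2 / L ^ 2 * cotFunctional L (θ t) ^ 2 ≤ 2 / π * ∫ x in (0 : ℝ)..L / 2,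
      (-(u x * D x) + θ t x * deriv (θ t) x) * Real.cot (π * x / L)
    rw [hsplit, mul_add, hT1]
    have h2π : 0 ≤ 2 / π * ∫ x in (0 : ℝ)..L / 2, θ t x * ω t x * V' x :=
      mul_nonneg (by positivity) hT1nn
    unfold cotFunctional
    linarith

end ChoiEtAl2017

end Literature.Analysis.FluidPDE
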